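import Summits.CriticalPhenomena.PercolationContinuityZ3.Theorems.FK.PressureConvexity
import Literature.Probability.LatticeModels.IsingThermodynamicsProofs
import Literature.Probability.LatticeModels.GriffithsMonotonicity
import Mathlib.Analysis.Convex.Continuous
import HarnessLib

/-!
# THE ISING PRESSURE IS JOINTLY CONVEX IN THE CANONICAL COUPLINGS `(J, H) = (β, βh)`:
# the two-parameter Gibbs–Bogoliubov chord inequality, `(J,H) ↦ log Z_Λ(J, H/J)` and `(J,H) ↦ ψ(J, H/J)` convex on
# `(0,∞) × ℝ`, and `(β,h) ↦ ψ(β,h)` jointly continuous on `(0,∞) × ℝ`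
# (Friedli–Velenik 2017, Lemma 3.5 / Exercise 3.2 / Thm. 3.6; Griffiths 1972, §II.D; Ruelle 1969, §2.6)

Claimed R42 (8)(c) in the cell INBOX at 2026-08-29T04:00:50Z by fkp-10a gen 358 (NEW CLAIM #1 of the gen), addressed to coordinator fk-4 (next seated gen; gen 288 closed l.8706, (ι) in force); lineage row FO-10a-g358 (self-suggested), package g358-surface, label PS-B.
Helper file of the `fk-continuity` build cell (bschramm lane; `--supports stmt-CriticalPhenomena-4575`); builds on
p205010 (kernel theorem, internal audit signed; external expert review pending). No definitions, no named facts, no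
sorries; standard axioms. UNCONDITIONAL (nearest-neighbour Ising model; finite-volume part on ANY locally finite graph
with ANY boundary condition).

In the tree's parametrisation the Boltzmann weight is `exp(β Σ_e σ_e + βh Σ_x σ_x)`; the exponent is LINEAR in the
canonical couplings `J = β`, `H = βh`, so `(J,H) ↦ log Z` is a convex function of two variables (Hölder / Gibbs–Jensen),
whereas `(β,h) ↦ log Z` itself is not. The tree has the two one-parameter slices (`convexOn_pressure_beta` at fixed
`h`, a ray through the origin of the `(J,H)`-plane, and `convexOn_pressure_field` at fixed `β`, a vertical line); this
file proves the full two-parameter statement and draws the joint continuity of `ψ`.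

* **`isingExpect_sub_le_log_sub`** — the TWO-PARAMETER GIBBS–BOGOLIUBOV CHORD INEQUALITY (any graph, volume, b.c.):
  `⟨β₁ H_{h₁} − β₂ H_{h₂}⟩_{Λ;β₁,h₁} ≤ log Z_{Λ;β₂,h₂} − log Z_{Λ;β₁,h₁}`, i.e. (`mul_add_mul_le_log_sub`)
  `(β₂ − β₁) ⟨Σ_e σ_e⟩_{β₁,h₁} + (β₂h₂ − β₁h₁) ⟨Σ_x σ_x⟩_{β₁,h₁} ≤ log Z(β₂,h₂) − log Z(β₁,h₁)`: the plane through
  `(β₁, β₁h₁, log Z)` with gradient `(⟨Σ_e σ_e⟩, ⟨Σ_x σ_x⟩)` supports the graph of `(J,H) ↦ log Z(J, H/J)`;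
* `convexOn_of_forall_exists_support_on` — supporting planes at every point of a convex set give convexity there (pure);
* **`convexOn_log_isingPartitionFunction_canonical`**, `convexOn_pressureIn_canonical` — for every finite graph piece and
  boundary condition, `(J,H) ↦ log Z^{bc}_Λ(J, H/J)` and `ψ^{bc}_Λ(J, H/J)` are convex on `(0,∞) × ℝ`;
* **`convexOn_pressure_canonical`** — `(J,H) ↦ ψ(J, H/J)` is convex on `(0,∞) × ℝ` (pointwise box limit, the lineage's
  `convexOn_prod_of_tendsto`); `pressure_convex_combination_le` — the same in the `(β,h)` coordinates:
  `ψ(aβ₁ + bβ₂, (aβ₁h₁ + bβ₂h₂)/(aβ₁ + bβ₂)) ≤ a ψ(β₁,h₁) + b ψ(β₂,h₂)`;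
* **`continuousOn_pressure_uncurry`**, `continuousAt_pressure_uncurry` — `(β,h) ↦ ψ(β,h)` IS JOINTLY CONTINUOUS on the open
  half-plane `{β > 0}` (a convex function on an open subset of `ℝ²` is continuous — Mathlib `ConvexOn.continuousOn` — and
  `(β,h) ↦ (β, βh)` is a homeomorphism of the half-plane).

## References

* S. Friedli, Y. Velenik, *Statistical Mechanics of Lattice Systems*, CUP (2017), Lemma 3.5, Exercise 3.2, Thm. 3.6,
  §3.2.1. [FriedliVelenik2017]
* R. B. Griffiths, *Rigorous results and theorems*, in: Phase Transitions and Critical Phenomena 1 (Domb–Green eds.),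
  Academic Press (1972), §II.D (convexity of the free energy in all coupling constants). [Griffiths1972]
* D. Ruelle, *Statistical Mechanics: Rigorous Results*, Benjamin (1969), §2.6 (convexity of the pressure,
  Prop. 2.6.2/3). [Ruelle1969]
-/

noncomputable section

namespace Summit.CriticalPhenomena.PercolationContinuityZ3.Theorems.FK

namespace IsingPressure

open MeasureTheory Filter Topology Finset Set
open Literature.Probability.LatticeModels

variable {d : ℕ}

/-! ### Supporting planes on a convex set give convexity -/

/-- **Supporting planes give convexity, on a convex set**: if at every `z ∈ s` some plane through `(z, f z)` lies below
the graph of `f` over `s`, then `f` is convex on `s` (the convex-set version of the lineage's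
`convexOn_of_forall_exists_support₂`). [cite: Rockafellar1970, Thm. 24.1 and Cor. 10.1.1] -/
theorem convexOn_of_forall_exists_support_on {s : Set (ℝ × ℝ)} (hs : Convex ℝ s) {f : ℝ × ℝ → ℝ}
    (h : ∀ z ∈ s, ∃ m : ℝ × ℝ, ∀ x ∈ s, f z + m.1 * (x.1 - z.1) + m.2 * (x.2 - z.2) ≤ f x) :
    ConvexOn ℝ s f := by
  refine ⟨hs, fun x hx y hy a b ha hb hab => ?_⟩
  obtain ⟨m, hm⟩ := h (a • x + b • y) (hs hx hy ha hb hab)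
  have h1 := mul_le_mul_of_nonneg_left (hm x hx) ha
  have h2 := mul_le_mul_of_nonneg_left (hm y hy) hb
  simp only [smul_eq_mul, Prod.smul_fst, Prod.smul_snd, Prod.fst_add, Prod.snd_add] at h1 h2 ⊢
  obtain rfl : b = 1 - a := by linarith
  nlinarith [h1, h2]

/-! ### Finite volume: the two-parameter Gibbs–Bogoliubov chord inequality -/

section FiniteVolume

variable {V : Type*} (G : SimpleGraph V) [DecidableEq V] [G.LocallyFinite]

/-- **The two-parameter Gibbs–Bogoliubov chord inequality**: for every volume, boundary condition and parameters,
`⟨β₁ H_{Λ;h₁} − β₂ H_{Λ;h₂}⟩_{Λ;β₁,h₁} ≤ log Z_{Λ;β₂,h₂} − log Z_{Λ;β₁,h₁}`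
(`Z₂/Z₁ = ⟨e^{β₁H₁ − β₂H₂}⟩_{β₁,h₁} ≥ e^{⟨β₁H₁ − β₂H₂⟩}` by Jensen). The one-parameter case `h₁ = h₂` is the tree's
`mul_isingExpect_neg_hamiltonian_le_log_sub`. [cite: FriedliVelenik2017, Lemma 3.5 and Exercise 3.2; Ruelle1969, §2.6] -/
theorem isingExpect_sub_le_log_sub (Λ : Finset V) (β₁ h₁ β₂ h₂ : ℝ) (bc : BoundaryCondition V) :
    isingExpect G Λ β₁ h₁ bc (fun σ => β₁ * isingHamiltonian G Λ h₁ bc σ - β₂ * isingHamiltonian G Λ h₂ bc σ) ≤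
      Real.log (isingPartitionFunction G Λ β₂ h₂ bc) - Real.log (isingPartitionFunction G Λ β₁ h₁ bc) := by
  have hZ₁ := isingPartitionFunction_pos G Λ β₁ h₁ bc
  have hZ₂ := isingPartitionFunction_pos G Λ β₂ h₂ bc
  set g : SpinConfig V → ℝ := fun σ => β₁ * isingHamiltonian G Λ h₁ bc σ - β₂ * isingHamiltonian G Λ h₂ bc σ with hg
  have hgm : Measurable g :=
    ((measurable_isingHamiltonian G Λ h₁ bc).const_mul β₁).sub ((measurable_isingHamiltonian G Λ h₂ bc).const_mul β₂)
  -- the expectation as a finite Boltzmann average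
  have hE : isingExpect G Λ β₁ h₁ bc g =
      ∑ τ : Λ → ℤˣ, (isingWeight G Λ β₁ h₁ bc τ / isingPartitionFunction G Λ β₁ h₁ bc) * g (glue Λ τ bc) := by
    rw [isingExpect, integral_isingMeasure G Λ β₁ h₁ bc hgm, Finset.sum_div]
    exact Finset.sum_congr rfl fun τ _ => by ring
  -- `Z₂/Z₁` as a Boltzmann average of `exp g`
  have hratio : isingPartitionFunction G Λ β₂ h₂ bc / isingPartitionFunction G Λ β₁ h₁ bc =
      ∑ τ : Λ → ℤˣ, (isingWeight G Λ β₁ h₁ bc τ / isingPartitionFunction G Λ β₁ h₁ bc) *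
        Real.exp (g (glue Λ τ bc)) := by
    rw [show isingPartitionFunction G Λ β₂ h₂ bc = ∑ τ : Λ → ℤˣ, isingWeight G Λ β₂ h₂ bc τ from rfl,
      Finset.sum_div]
    refine Finset.sum_congr rfl fun τ _ => ?_
    rw [isingWeight, isingWeight, div_mul_eq_mul_div, ← Real.exp_add]
    congr 2
    rw [hg]
    ring
  -- Jensen's inequality for `exp`
  have hJ : Real.exp (∑ τ : Λ → ℤˣ, (isingWeight G Λ β₁ h₁ bc τ / isingPartitionFunction G Λ β₁ h₁ bc) *
      g (glue Λ τ bc)) ≤ isingPartitionFunction G Λ β₂ h₂ bc / isingPartitionFunction G Λ β₁ h₁ bc := by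
    rw [hratio]
    have hw : ∑ τ : Λ → ℤˣ, isingWeight G Λ β₁ h₁ bc τ / isingPartitionFunction G Λ β₁ h₁ bc = 1 := by
      rw [← Finset.sum_div, div_eq_one_iff_eq hZ₁.ne']
      rfl
    have := convexOn_exp.map_sum_le (t := (Finset.univ : Finset (Λ → ℤˣ)))
      (w := fun τ : Λ → ℤˣ => isingWeight G Λ β₁ h₁ bc τ / isingPartitionFunction G Λ β₁ h₁ bc)
      (p := fun τ => g (glue Λ τ bc))
      (fun τ _ => (div_pos (isingWeight_pos G Λ β₁ h₁ bc τ) hZ₁).le) hw (fun τ _ => Set.mem_univ _)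
    simpa only [smul_eq_mul] using this
  have hlog := Real.log_le_log (Real.exp_pos _) hJ
  rw [Real.log_exp, Real.log_div hZ₂.ne' hZ₁.ne'] at hlog
  rwa [hE]

/-- **The chord inequality in linear form**: `β₁H_{h₁} − β₂H_{h₂} = (β₂ − β₁) Σ_e σ_e + (β₂h₂ − β₁h₁) Σ_x σ_x`, so
`(β₂ − β₁) ⟨Σ_{e∈ℰ^{bc}_Λ} σ_e⟩_{Λ;β₁,h₁} + (β₂h₂ − β₁h₁) ⟨Σ_{x∈Λ} σ_x⟩_{Λ;β₁,h₁} ≤ log Z_{Λ;β₂,h₂} − log Z_{Λ;β₁,h₁}`: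
in the canonical couplings `(J,H) = (β, βh)` the plane with gradient `(⟨Σ_e σ_e⟩, ⟨Σ_x σ_x⟩)` through the point
`(β₁, β₁h₁)` supports the graph of `log Z`. [cite: FriedliVelenik2017, Lemma 3.5 and Exercise 3.2; Griffiths1972, §II.D] -/
theorem mul_add_mul_le_log_sub (Λ : Finset V) (β₁ h₁ β₂ h₂ : ℝ) (bc : BoundaryCondition V) :
    (β₂ - β₁) * isingExpect G Λ β₁ h₁ bc (fun σ => ∑ e ∈ interactionEdges G Λ bc, bondSpin σ e) +
        (β₂ * h₂ - β₁ * h₁) * isingExpect G Λ β₁ h₁ bc (fun σ => ∑ x ∈ Λ, spinAt x σ) ≤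
      Real.log (isingPartitionFunction G Λ β₂ h₂ bc) - Real.log (isingPartitionFunction G Λ β₁ h₁ bc) := by
  have hmE : Measurable fun σ : SpinConfig V => ∑ e ∈ interactionEdges G Λ bc, bondSpin σ e :=
    Finset.measurable_sum _ fun e _ => measurable_bondSpin e
  have hmV : Measurable fun σ : SpinConfig V => ∑ x ∈ Λ, spinAt x σ :=
    Finset.measurable_sum _ fun x _ => measurable_spinAt x
  have h1 := isingExpect_sub_le_log_sub G Λ β₁ h₁ β₂ h₂ bc
  have hfun : (fun σ => β₁ * isingHamiltonian G Λ h₁ bc σ - β₂ * isingHamiltonian G Λ h₂ bc σ) =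
      fun σ => (β₂ - β₁) * (∑ e ∈ interactionEdges G Λ bc, bondSpin σ e) +
        (β₂ * h₂ - β₁ * h₁) * ∑ x ∈ Λ, spinAt x σ := by
    funext σ; unfold isingHamiltonian; ring
  rw [hfun, isingExpect_add' G Λ h₁ bc β₁ (hmE.const_mul _) (hmV.const_mul _),
    isingExpect_const_mul' G Λ h₁ bc β₁ _ hmE, isingExpect_const_mul' G Λ h₁ bc β₁ _ hmV] at h1
  exact h1

/-- **`(J,H) ↦ log Z^{bc}_Λ(J, H/J)` IS CONVEX ON `(0,∞) × ℝ`** (every finite graph piece, every boundary condition):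
`log Z` is jointly convex in the canonical couplings `J = β`, `H = βh`. [cite: FriedliVelenik2017, Lemma 3.5 and Exercise 3.2; Griffiths1972, §II.D; Ruelle1969, §2.6] -/
theorem convexOn_log_isingPartitionFunction_canonical (Λ : Finset V) (bc : BoundaryCondition V) :
    ConvexOn ℝ (Ioi (0 : ℝ) ×ˢ univ)
      (fun p : ℝ × ℝ => Real.log (isingPartitionFunction G Λ p.1 (p.2 / p.1) bc)) := by
  refine convexOn_of_forall_exists_support_on ((convex_Ioi 0).prod convex_univ) fun z hz => ?_
  have hz1 : 0 < z.1 := (mem_prod.1 hz).1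
  refine ⟨(isingExpect G Λ z.1 (z.2 / z.1) bc (fun σ => ∑ e ∈ interactionEdges G Λ bc, bondSpin σ e),
    isingExpect G Λ z.1 (z.2 / z.1) bc (fun σ => ∑ x ∈ Λ, spinAt x σ)), fun x hx => ?_⟩
  have hx1 : 0 < x.1 := (mem_prod.1 hx).1
  have h := mul_add_mul_le_log_sub G Λ z.1 (z.2 / z.1) x.1 (x.2 / x.1) bc
  have e1 : x.1 * (x.2 / x.1) - z.1 * (z.2 / z.1) = x.2 - z.2 := by field_simp
  rw [e1] at h
  linarith

/-- **`(J,H) ↦ ψ^{bc}_Λ(J, H/J)` is convex on `(0,∞) × ℝ`.** [cite: FriedliVelenik2017, Lemma 3.5 and Exercise 3.2] -/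
theorem convexOn_pressureIn_canonical (Λ : Finset V) (bc : BoundaryCondition V) :
    ConvexOn ℝ (Ioi (0 : ℝ) ×ˢ univ) (fun p : ℝ × ℝ => pressureIn G Λ p.1 (p.2 / p.1) bc) := by
  have hc : (0 : ℝ) ≤ (#Λ : ℝ)⁻¹ := inv_nonneg.2 (Nat.cast_nonneg _)
  refine ((convexOn_log_isingPartitionFunction_canonical G Λ bc).smul hc).congr fun p _ => ?_
  simp only [pressureIn, smul_eq_mul, div_eq_inv_mul]

end FiniteVolume

/-! ### Infinite volume: joint convexity in the canonical couplings -/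

/-- **THE PRESSURE IS JOINTLY CONVEX IN THE CANONICAL COUPLINGS**: `(J,H) ↦ ψ(J, H/J)` is convex on `(0,∞) × ℝ`
(pointwise box limit of the convex finite-volume pressures, `hasBoxLimit_pressureIn_holds`). [cite: FriedliVelenik2017, Thm. 3.6 and Lemma 3.5; Griffiths1972, §II.D; Ruelle1969, §2.6] -/
theorem convexOn_pressure_canonical :
    ConvexOn ℝ (Ioi (0 : ℝ) ×ˢ univ) (fun p : ℝ × ℝ => pressure d p.1 (p.2 / p.1)) :=
  convexOn_prod_of_tendsto ((convex_Ioi 0).prod convex_univ)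
    (f := fun (L : ℕ) (p : ℝ × ℝ) => pressureIn (zdGraph d) (box d L) p.1 (p.2 / p.1) .free)
    (fun L => convexOn_pressureIn_canonical (zdGraph d) (box d L) .free) fun p _ =>
      (hasBoxLimit_pressureIn_holds (d := d) p.1 (p.2 / p.1) .free :)

/-- **Joint convexity in the `(β,h)` coordinates**: for `β₁, β₂ > 0`, `a, b ≥ 0`, `a + b = 1`,
`ψ(aβ₁ + bβ₂, (aβ₁h₁ + bβ₂h₂)/(aβ₁ + bβ₂)) ≤ a ψ(β₁,h₁) + b ψ(β₂,h₂)` (the point of the `(J,H)`-segment from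
`(β₁, β₁h₁)` to `(β₂, β₂h₂)`). [cite: FriedliVelenik2017, Thm. 3.6 and Lemma 3.5; Griffiths1972, §II.D] -/
theorem pressure_convex_combination_le {β₁ β₂ a b : ℝ} (hβ₁ : 0 < β₁) (hβ₂ : 0 < β₂) (ha : 0 ≤ a) (hb : 0 ≤ b)
    (hab : a + b = 1) (h₁ h₂ : ℝ) :
    pressure d (a * β₁ + b * β₂) ((a * (β₁ * h₁) + b * (β₂ * h₂)) / (a * β₁ + b * β₂)) ≤
      a * pressure d β₁ h₁ + b * pressure d β₂ h₂ := by
  have h := (convexOn_pressure_canonical (d := d)).2 (x := (β₁, β₁ * h₁)) (y := (β₂, β₂ * h₂))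
    (mk_mem_prod hβ₁ (mem_univ _)) (mk_mem_prod hβ₂ (mem_univ _)) ha hb hab
  simp only [smul_eq_mul, Prod.smul_mk, Prod.mk_add_mk] at h
  rwa [mul_div_cancel_left₀ _ hβ₁.ne', mul_div_cancel_left₀ _ hβ₂.ne'] at h

/-! ### Joint continuity of `(β,h) ↦ ψ(β,h)` on the open half-plane -/

/-- **`(J,H) ↦ ψ(J, H/J)` is continuous on `(0,∞) × ℝ`** (a convex function on an open subset of `ℝ²`).
[cite: FriedliVelenik2017, Thm. 3.6; Rockafellar1970, Thm. 10.1] -/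
theorem continuousOn_pressure_canonical :
    ContinuousOn (fun p : ℝ × ℝ => pressure d p.1 (p.2 / p.1)) (Ioi (0 : ℝ) ×ˢ univ) :=
  (convexOn_pressure_canonical (d := d)).continuousOn (isOpen_Ioi.prod isOpen_univ)

/-- **THE PRESSURE IS JOINTLY CONTINUOUS IN `(β,h)` ON `{β > 0}`**: `ContinuousOn (fun (β,h) => ψ(β,h)) ((0,∞) × ℝ)`
(`ψ(β,h) = Ψ(β, βh)` with `Ψ(J,H) = ψ(J, H/J)` continuous and `(β,h) ↦ (β, βh)` continuous). [cite: FriedliVelenik2017, Thm. 3.6; Griffiths1972, §II.D] -/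
theorem continuousOn_pressure_uncurry :
    ContinuousOn (fun p : ℝ × ℝ => pressure d p.1 p.2) (Ioi (0 : ℝ) ×ˢ univ) := by
  have hΦ : ContinuousOn (fun p : ℝ × ℝ => (p.1, p.1 * p.2)) (Ioi (0 : ℝ) ×ˢ univ) :=
    (continuous_fst.prodMk (continuous_fst.mul continuous_snd)).continuousOn
  have hmaps : MapsTo (fun p : ℝ × ℝ => (p.1, p.1 * p.2)) (Ioi (0 : ℝ) ×ˢ univ) (Ioi (0 : ℝ) ×ˢ univ) :=
    fun p hp => mk_mem_prod (mem_prod.1 hp).1 (mem_univ _)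
  refine ((continuousOn_pressure_canonical (d := d)).comp hΦ hmaps).congr fun p hp => ?_
  have hp1 : p.1 ≠ 0 := ne_of_gt (mem_prod.1 hp).1
  simp only [Function.comp_apply, mul_div_cancel_left₀ _ hp1]

/-- **`(β,h) ↦ ψ(β,h)` is continuous at every `(β,h)` with `β > 0`.** [cite: FriedliVelenik2017, Thm. 3.6; Griffiths1972, §II.D] -/
theorem continuousAt_pressure_uncurry {β : ℝ} (hβ : 0 < β) (h : ℝ) :
    ContinuousAt (fun p : ℝ × ℝ => pressure d p.1 p.2) (β, h) :=
  (continuousOn_pressure_uncurry (d := d)).continuousAt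
    ((isOpen_Ioi.prod isOpen_univ).mem_nhds (mk_mem_prod hβ (mem_univ _)))

/-- **Joint continuity along any path**: if `βₙ → β > 0` and `hₙ → h` then `ψ(βₙ,hₙ) → ψ(β,h)`. [cite: FriedliVelenik2017, Thm. 3.6] -/
theorem tendsto_pressure_of_tendsto {ι : Type*} {l : Filter ι} {b t : ι → ℝ} {β h : ℝ} (hβ : 0 < β)
    (hb : Tendsto b l (𝓝 β)) (ht : Tendsto t l (𝓝 h)) :
    Tendsto (fun i => pressure d (b i) (t i)) l (𝓝 (pressure d β h)) :=
  ((continuousAt_pressure_uncurry (d := d) hβ h).tendsto.comp (hb.prodMk_nhds ht) :)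

end IsingPressure

end Summit.CriticalPhenomena.PercolationContinuityZ3.Theorems.FK

end
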